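import Summits.ValiantsHypothesis.ValiantsHypothesis.Theorems.HartogsRankTwoFactorSideEasyExpansion
import Literature.Computability.AlgebraicComplexity.HamiltonianCycleVNP

/-!
# ValiantsHypothesis / HartogsRankTwo — item `FactorSideEasy` (stmt-ValiantsHypothesis-10335), closed

The pullback `per_n(U Vᵀ) ∈ ℂ[U, V]` of the permanent to the rank-`≤ 2` parametrisation
`x_{ri} = Σ_{t<2} U_{rt} V_{it}` has p-bounded circuit complexity (Barvinok's rank-two permanent).
By part 1 (`bind₁_perPoly_rankTwo_eq_sum_layers`), `per_n(U Vᵀ) = Σ_{k ≤ n} N_{n,k} · E_k(V) · E_k(U)`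
with the layer sums `E_k(Y) = [s^k] Π_i (s Y_{i,0} + Y_{i,1})`; each `E_k` is a fixed linear combination
(inverse Vandermonde at the nodes `0, 1, …, n`) of the `n + 1` products `Π_i (j·Y_{i,0} + Y_{i,1})`
(`layerSum_eq_interpolation`), so `L(E_k) = O(n²)` and `L(per_n(U Vᵀ)) = O(n³)` by the cost calculus of
`ArithCircuitProofs` (`L(f+g), L(fg) ≤ L(f) + L(g) + 1`, inputs and constants free). (Barvinok 1996 computes
it in `O(n²)` by sharing the two tables; the formula bound `9 (n+1)³` suffices for `IsPBounded`.)
HONEST FRAMING: the "easy half" of a dormant route's dichotomy; nothing here bears on `VP ≠ VNP`.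
-/

-- layout Summits/ValiantsHypothesis/ValiantsHypothesis forces the duplicated namespace component
set_option linter.dupNamespace false

noncomputable section

namespace Summit.ValiantsHypothesis.ValiantsHypothesis.Theorems.HartogsRankTwo

open MvPolynomial Literature.Computability.AlgebraicComplexity

variable {n : ℕ}

/-! ### Layer sums by interpolation -/

/-- The product `Π_i (s·Y_{(i,0)} + Y_{(i,1)})` at a scalar node `s`. [folklore] -/
def nodeProd (ι : Fin n × Fin 2 → FSVars n) (s : ℂ) : MvPolynomial (FSVars n) ℂ :=
  ∏ i : Fin n, (C s * X (ι (i, 0)) + X (ι (i, 1)))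

/-- `Π_i (s Y_{(i,0)} + Y_{(i,1)}) = Σ_{k ≤ n} s^k E_k(Y)`. [folklore] -/
theorem nodeProd_eq_sum_layers (ι : Fin n × Fin 2 → FSVars n) (s : ℂ) :
    nodeProd ι s = ∑ k ∈ Finset.range (n + 1), C (s ^ k) * layerSum ι k := by
  classical
  unfold nodeProd
  rw [Finset.prod_add, Finset.powerset_card_disjiUnion, Finset.sum_disjiUnion, Finset.card_univ,
    Fintype.card_fin]
  refine Finset.sum_congr rfl fun k _ => ?_
  rw [layerSum, Finset.mul_sum]
  refine Finset.sum_congr rfl fun S hS => ?_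
  rw [Finset.prod_mul_distrib, Finset.prod_const, ← map_pow, (Finset.mem_powersetCard.1 hS).2, mixedMono,
    mul_assoc]

/-- The Vandermonde matrix at the nodes `0, 1, …, n`. [folklore] -/
def nodeVandermonde (n : ℕ) : Matrix (Fin (n + 1)) (Fin (n + 1)) ℂ :=
  Matrix.vandermonde fun j : Fin (n + 1) => (j : ℂ)

/-- The node Vandermonde matrix is invertible (the nodes are distinct). [folklore] -/
theorem isUnit_det_nodeVandermonde (n : ℕ) : IsUnit (nodeVandermonde n).det := by
  rw [isUnit_iff_ne_zero, nodeVandermonde, Matrix.det_vandermonde_ne_zero_iff]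
  intro i j h
  have h' : ((i : ℕ) : ℂ) = ((j : ℕ) : ℂ) := h
  exact Fin.ext (Nat.cast_injective h')

/-- **Interpolation.** `E_k(Y) = Σ_j (W⁻¹)_{kj} Π_i (j·Y_{(i,0)} + Y_{(i,1)})` with `W` the node Vandermonde
matrix. [folklore] -/
theorem layerSum_eq_interpolation (ι : Fin n × Fin 2 → FSVars n) (k : Fin (n + 1)) :
    layerSum ι k = ∑ j : Fin (n + 1), C ((nodeVandermonde n)⁻¹ k j) * nodeProd ι (j : ℂ) := by
  have hW := Matrix.nonsing_inv_mul (nodeVandermonde n) (isUnit_det_nodeVandermonde n)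
  symm
  calc ∑ j : Fin (n + 1), C ((nodeVandermonde n)⁻¹ k j) * nodeProd ι (j : ℂ)
      = ∑ j : Fin (n + 1), ∑ l : Fin (n + 1),
          C ((nodeVandermonde n)⁻¹ k j * nodeVandermonde n j l) * layerSum ι l := by
        refine Finset.sum_congr rfl fun j _ => ?_
        rw [nodeProd_eq_sum_layers, Finset.sum_range (fun l => C (((j : ℕ) : ℂ) ^ l) * layerSum ι l),
          Finset.mul_sum]
        refine Finset.sum_congr rfl fun l _ => ?_
        rw [← mul_assoc, ← map_mul, nodeVandermonde, Matrix.vandermonde_apply]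
    _ = ∑ l : Fin (n + 1), C (((nodeVandermonde n)⁻¹ * nodeVandermonde n) k l) * layerSum ι l := by
        rw [Finset.sum_comm]
        refine Finset.sum_congr rfl fun l _ => ?_
        rw [Matrix.mul_apply, map_sum, Finset.sum_mul]
    _ = layerSum ι k := by
        rw [hW]
        rw [Finset.sum_eq_single k]
        · rw [Matrix.one_apply_eq, map_one, one_mul]
        · intro l _ hl
          rw [Matrix.one_apply_ne (Ne.symm hl), map_zero, zero_mul]
        · intro h; exact absurd (Finset.mem_univ k) h

/-! ### Cost bounds -/

/-- `L(Π_i (s Y_{(i,0)} + Y_{(i,1)})) ≤ 3n` (inputs and constants are free). [folklore] -/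
theorem complexity_nodeProd_le (ι : Fin n × Fin 2 → FSVars n) (s : ℂ) :
    complexity (nodeProd ι s) ≤ n * 2 + n := by
  unfold nodeProd
  refine (complexity_prod_le_of_le _ _ 2 fun i _ => ?_).trans (by simp)
  have h1 := complexity_add_le_holds (C s * X (ι (i, 0)) : MvPolynomial (FSVars n) ℂ) (X (ι (i, 1)))
  have h2 := complexity_mul_le_holds (C s : MvPolynomial (FSVars n) ℂ) (X (ι (i, 0)))
  have h3 := complexity_C_holds (σ := FSVars n) s
  have h4 := complexity_X_holds (k := ℂ) (ι (i, 0))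
  have h5 := complexity_X_holds (k := ℂ) (ι (i, 1))
  omega

/-- `L(E_k(Y)) ≤ (n+1)(3n+1) + (n+1)`. [folklore] -/
theorem complexity_layerSum_le (ι : Fin n × Fin 2 → FSVars n) (k : Fin (n + 1)) :
    complexity (layerSum ι k) ≤ (n + 1) * (n * 2 + n + 1) + (n + 1) := by
  rw [layerSum_eq_interpolation]
  refine (complexity_sum_le_of_le _ _ (n * 2 + n + 1) fun j _ => ?_).trans (by simp)
  have h1 := complexity_mul_le_holds (C ((nodeVandermonde n)⁻¹ k j) : MvPolynomial (FSVars n) ℂ)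
    (nodeProd ι (j : ℂ))
  have h2 := complexity_C_holds (σ := FSVars n) ((nodeVandermonde n)⁻¹ k j)
  have h3 := complexity_nodeProd_le ι (j : ℂ)
  omega

/-- **`L(per_n(U Vᵀ)) = O(n³)`.** [folklore] -/
theorem complexity_rankTwoPer_le (n : ℕ) :
    complexity (bind₁ (fun ij : Fin n × Fin n => ∑ t : Fin 2,
        (X (Sum.inl (ij.1, t)) * X (Sum.inr (ij.2, t)) : MvPolynomial (FSVars n) ℂ))
      (perPoly (Fin n) ℂ)) ≤
      (n + 1) * (2 * ((n + 1) * (n * 2 + n + 1) + (n + 1)) + 2) + (n + 1) := by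
  rw [bind₁_perPoly_rankTwo_eq_sum_layers, Finset.sum_range]
  refine (complexity_sum_le_of_le _ _ (2 * ((n + 1) * (n * 2 + n + 1) + (n + 1)) + 2)
    fun k _ => ?_).trans (by simp)
  have h1 := complexity_smul_le_holds (refCount n k : ℂ)
    (layerSum (n := n) Sum.inr k * layerSum (n := n) Sum.inl k)
  have h2 := complexity_mul_le_holds (layerSum (n := n) Sum.inr k) (layerSum (n := n) Sum.inl k)
  have h3 := complexity_layerSum_le (n := n) Sum.inr k
  have h4 := complexity_layerSum_le (n := n) Sum.inl k
  omega

/-- **Item `FactorSideEasy` (stmt-ValiantsHypothesis-10335).** The rank-two pullback of the permanent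
has p-bounded complexity: `L(per_n(U Vᵀ)) ≤ 9 (n+1)³`. [folklore] -/
theorem factorSideEasy_proof : Theses.HartogsRankTwo.FactorSideEasy := by
  unfold Theses.HartogsRankTwo.FactorSideEasy
  refine (IsPBounded.iff_exists_le_mul_succ_pow _).2 ⟨9, 3, fun n => ?_⟩
  refine (complexity_rankTwoPer_le n).trans ?_
  have h1 : n * 2 + n + 1 ≤ 3 * (n + 1) := by omega
  have h2 : (n + 1) * (n * 2 + n + 1) + (n + 1) ≤ 4 * (n + 1) ^ 2 := by nlinarith
  nlinarith [h2, Nat.zero_le n]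

end Summit.ValiantsHypothesis.ValiantsHypothesis.Theorems.HartogsRankTwo

end
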